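import Summits.NavierStokesRegularity.NavierStokesRegularity.Theorems.GaldiLiouvilleGateAllAxesCoreTools
import HarnessLib

/-!
# Galdi's Liouville problem ⟨0895⟩, line «all-axes cylinder budget», piece O1c (5c/·): the three packages
# of the one-stroke test function — tested identity, cut-off error, zone bounds

Route `GaldiLiouvilleGate`, items ⟨0895⟩/⟨0896⟩; LINE allaxes/cylbudget, combined Defs v3.1
(817120c4c833a18a), obligation O1c′ `CylinderBookkeepingSplit` (BLUEPRINT §2–§3, Remark 15).  For the test
function `ψ = χ(x₂)·M(x₀²+x₁²)` (pieces 2–4): `core_identity` (the two tested integrands are integrable and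
their integrals sum to `0`, piece 1), `core_error` (the cap/cut-off error `E`: continuous, integrable, supported in
`{s ≤ 4T²} ∩ {Z ≤ |x₂| ≤ Z+1}`, `|E| ≤ K(T²+T)(c−P)`), `core_zone_bounds` (the swirl-excess density `W` on the
five radial zones, from piece 5a and the profile of piece 3).

[folklore; cite: KorobkovPileckasRusso2015 (Wang monograph Thm 3.5–3.6, the cylinder identities)]
No summit / no ⟨0895⟩–⟨0896⟩ claim is proved here; NS regularity is not touched.
-/

noncomputable section

-- the problem directory repeats the summit name (D-0017); core's `dupNamespace` linter fires
set_option linter.dupNamespace false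

open MeasureTheory Set Filter Topology InnerProductSpace Function Metric
open scoped RealInnerProductSpace Laplacian Topology ENNReal

namespace Summit.NavierStokesRegularity.NavierStokesRegularity.Theorems.GaldiLiouville.AllAxesBudget

open Literature.Analysis.FluidPDE

/-- **The tested identity, explicitly.**  For the one-stroke test function `ψ = χ(x₂)M(s)` the two
tested integrands `(P − c)Δψ` and `D²ψ(U,U)` (pieces 1 and 4) are integrable and their integrals sum to `0`. -/
theorem core_identity {ν : ℝ} {U : EuclideanSpace ℝ (Fin 3) → EuclideanSpace ℝ (Fin 3)} {P : EuclideanSpace ℝ (Fin 3) → ℝ}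
    (hprof : IsLerayProfile ν 0 U P) (hU : ContDiff ℝ (⊤ : ℕ∞) U) (hP : ContDiff ℝ (⊤ : ℕ∞) P) (c : ℝ)
    {χ N M : ℝ → ℝ} {T Z : ℝ} (hχC : ContDiff ℝ (⊤ : ℕ∞) χ) (hχ0 : ∀ z, Z + 1 ≤ |z| → χ z = 0)
    (hNC : ContDiff ℝ (⊤ : ℕ∞) N) (hMC : ContDiff ℝ (⊤ : ℕ∞) M) (hMN : ∀ s, HasDerivAt M (N s / 2) s)
    (hN4T : ∀ s, 4 * T ^ 2 ≤ s → N s = 0 ∧ deriv N s = 0 ∧ M s = 0)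
    (f₁ f₂ : EuclideanSpace ℝ (Fin 3) → ℝ) (hf₁ : f₁ = (fun x : EuclideanSpace ℝ (Fin 3) => (P x - c) *
    (χ (x 2) * (2 * N (x 0 ^ 2 + x 1 ^ 2) + 2 * (x 0 ^ 2 + x 1 ^ 2) * deriv N (x 0 ^ 2 + x 1 ^ 2)) +
      deriv (deriv χ) (x 2) * M (x 0 ^ 2 + x 1 ^ 2))))
    (hf₂ : f₂ = (fun x : EuclideanSpace ℝ (Fin 3) =>
    χ (x 2) * (N (x 0 ^ 2 + x 1 ^ 2) * (U x 0 ^ 2 + U x 1 ^ 2) +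
        2 * deriv N (x 0 ^ 2 + x 1 ^ 2) * (x 0 * U x 0 + x 1 * U x 1) ^ 2) +
      2 * deriv χ (x 2) * N (x 0 ^ 2 + x 1 ^ 2) * ((x 0 * U x 0 + x 1 * U x 1) * U x 2) +
      deriv (deriv χ) (x 2) * M (x 0 ^ 2 + x 1 ^ 2) * U x 2 ^ 2)) :
    Integrable f₁ ∧ Integrable f₂ ∧ (∫ x, f₁ x) + (∫ x, f₂ x) = 0 := by
  have hχ2 : ContDiff ℝ 2 χ := contDiff_infty.1 hχC 2
  have hχ3 : ContDiff ℝ 3 χ := contDiff_infty.1 hχC 3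
  have hM2 : ContDiff ℝ 2 M := contDiff_infty.1 hMC 2
  have hM3 : ContDiff ℝ 3 M := contDiff_infty.1 hMC 3
  have hNd : Differentiable ℝ N := hNC.differentiable (by simp)
  have hχd_out : ∀ z, Z + 1 < |z| → deriv χ z = 0 ∧ deriv (deriv χ) z = 0 := fun z hz =>
    deriv_deriv_eq_zero_of_eventually_const (a := 0) (by
      filter_upwards [(isOpen_lt continuous_const continuous_abs).mem_nhds hz] with w hw
      exact hχ0 w hw.le)
  -- smoothness of the derivatives of `χ`
  have hχ'C : ContDiff ℝ (⊤ : ℕ∞) (deriv χ) := (contDiff_infty_iff_deriv.1 hχC).2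
  have hχ''C : ContDiff ℝ (⊤ : ℕ∞) (deriv (deriv χ)) := (contDiff_infty_iff_deriv.1 hχ'C).2
  have hN'C : ContDiff ℝ (⊤ : ℕ∞) (deriv N) := (contDiff_infty_iff_deriv.1 hNC).2
  have hco : ∀ i : Fin 3, Continuous fun y : EuclideanSpace ℝ (Fin 3) => y i := fun i =>
    (EuclideanSpace.proj (𝕜 := ℝ) i).continuous
  have hsC : Continuous fun y : EuclideanSpace ℝ (Fin 3) => y 0 ^ 2 + y 1 ^ 2 := ((hco 0).pow 2).add ((hco 1).pow 2)
  have hUc : ∀ i : Fin 3, Continuous fun y : EuclideanSpace ℝ (Fin 3) => U y i := fun i =>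
    (hco i).comp hU.continuous
  have hPc : Continuous P := hP.continuous
  -- ### the test function and the tested identity
  set ψ : EuclideanSpace ℝ (Fin 3) → ℝ := fun y => χ (y 2) * M (y 0 ^ 2 + y 1 ^ 2) with hψ
  have hψ3 : ContDiff ℝ 3 ψ := contDiff_cylTest hχ3 hM3
  have hψc : HasCompactSupport ψ :=
    hasCompactSupport_cylTest (Z₁ := Z + 1) (S₁ := 4 * T ^ 2) (by positivity) hχ0 (fun σ hσ => (hN4T σ hσ).2.2)
  have hid := integral_sub_mul_laplacian_add_hessian_eq_zero hprof hψ3 hψc c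
  -- the explicit integrands
  have hL : (fun x => (P x - c) * (Δ ψ) x) = f₁ := by
    funext x; rw [hf₁, laplacian_cylTest hχ2 hM2 hMN hNd x]
  have hH : (fun x => fderiv ℝ (fderiv ℝ ψ) x (U x) (U x)) = f₂ := by
    funext x; rw [hf₂, hessian_cylTest_apply hχ2 hM2 hMN hNd x (U x)]
  rw [hL, hH] at hid
  -- continuity and compact support of the integrands
  have hf₁c : Continuous f₁ := by
    rw [hf₁]
    refine (hPc.sub continuous_const).mul ?_
    exact ((hχC.continuous.comp (hco 2)).mul (((hNC.continuous.comp hsC).const_mul 2).add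
      ((hsC.const_mul 2).mul (hN'C.continuous.comp hsC)))).add
      ((hχ''C.continuous.comp (hco 2)).mul (hMC.continuous.comp hsC))
  have hf₂c : Continuous f₂ := by
    rw [hf₂]
    have hρ : Continuous fun x : EuclideanSpace ℝ (Fin 3) => x 0 * U x 0 + x 1 * U x 1 :=
      ((hco 0).mul (hUc 0)).add ((hco 1).mul (hUc 1))
    refine (((hχC.continuous.comp (hco 2)).mul (((hNC.continuous.comp hsC).mul
      (((hUc 0).pow 2).add ((hUc 1).pow 2))).add (((hN'C.continuous.comp hsC).const_mul 2).mul (hρ.pow 2)))).add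
      ((((hχ'C.continuous.comp (hco 2)).const_mul 2).mul (hNC.continuous.comp hsC)).mul (hρ.mul (hUc 2)))).add
      (((hχ''C.continuous.comp (hco 2)).mul (hMC.continuous.comp hsC)).mul ((hUc 2).pow 2))
  -- the compact set carrying everything
  set Kc : Set (EuclideanSpace ℝ (Fin 3)) := {x | x 0 ^ 2 + x 1 ^ 2 ≤ 4 * T ^ 2 ∧ |x 2| ≤ Z + 1} with hKc
  have hKcpt : IsCompact Kc := isCompact_solidCylinder _ _
  -- vanishing outside `Kc`: radial factors for `s > 4T²`, axial factors for `|x₂| > Z + 1`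
  have hvan : ∀ x : EuclideanSpace ℝ (Fin 3), x ∉ Kc →
      (N (x 0 ^ 2 + x 1 ^ 2) = 0 ∧ deriv N (x 0 ^ 2 + x 1 ^ 2) = 0 ∧ M (x 0 ^ 2 + x 1 ^ 2) = 0) ∨
      (χ (x 2) = 0 ∧ deriv χ (x 2) = 0 ∧ deriv (deriv χ) (x 2) = 0) := by
    intro x hx
    simp only [hKc, mem_setOf_eq, not_and_or, not_le] at hx
    rcases hx with hx | hx
    · exact Or.inl (hN4T _ hx.le)
    · exact Or.inr ⟨hχ0 _ hx.le, hχd_out _ hx⟩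
  have hf₁s : HasCompactSupport f₁ := by
    refine HasCompactSupport.of_support_subset_isCompact hKcpt fun x hx => ?_
    by_contra hxK
    apply hx
    show f₁ x = 0
    rcases hvan x hxK with ⟨h1, h2, h3⟩ | ⟨h1, h2, h3⟩
    · simp only [hf₁, h1, h2, h3]; ring
    · simp only [hf₁, h1, h3]; ring
  have hf₂s : HasCompactSupport f₂ := by
    refine HasCompactSupport.of_support_subset_isCompact hKcpt fun x hx => ?_
    by_contra hxK
    apply hx
    show f₂ x = 0
    rcases hvan x hxK with ⟨h1, h2, h3⟩ | ⟨h1, h2, h3⟩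
    · simp only [hf₂, h1, h2, h3]; ring
    · simp only [hf₂, h1, h2, h3]; ring
  have hf₁i : Integrable f₁ := hf₁c.integrable_of_hasCompactSupport hf₁s
  have hf₂i : Integrable f₂ := hf₂c.integrable_of_hasCompactSupport hf₂s
  exact ⟨hf₁i, hf₂i, hid⟩

/-- **The cut-off error `E`** of the one-stroke test function: continuous, integrable, supported in
`{s ≤ 4T²} ∩ {Z ≤ |x₂| ≤ Z+1}`, and `|E| ≤ K(T²+T)(c − P)` on `{s ≤ 4T²}` (density piece 5a). -/
theorem core_error {U : EuclideanSpace ℝ (Fin 3) → EuclideanSpace ℝ (Fin 3)} {P : EuclideanSpace ℝ (Fin 3) → ℝ}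
    (hU : ContDiff ℝ (⊤ : ℕ∞) U) (hP : ContDiff ℝ (⊤ : ℕ∞) P) {c : ℝ} (hQ : ∀ x, P x + ‖U x‖ ^ 2 / 2 ≤ c)
    {χ N M : ℝ → ℝ} {T Z A D K : ℝ} (hT0 : 0 < T) (hχC : ContDiff ℝ (⊤ : ℕ∞) χ)
    (hχ1 : ∀ z, |z| ≤ Z → χ z = 1) (hχ0 : ∀ z, Z + 1 ≤ |z| → χ z = 0)
    (hχ' : ∀ z, |deriv χ z| ≤ D) (hχ'' : ∀ z, |deriv (deriv χ) z| ≤ D)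
    (hNC : ContDiff ℝ (⊤ : ℕ∞) N) (hMC : ContDiff ℝ (⊤ : ℕ∞) M)
    (hN4T : ∀ s, 4 * T ^ 2 ≤ s → N s = 0 ∧ deriv N s = 0 ∧ M s = 0)
    (hN04 : ∀ s, 0 ≤ s → 0 ≤ N s ∧ N s ≤ 4) (hMb : ∀ s, 0 ≤ s → |M s| ≤ A * T ^ 2)
    (hK1 : 3 * D * (A * T ^ 2) + 32 * D * T ≤ K * (T ^ 2 + T))
    (E : EuclideanSpace ℝ (Fin 3) → ℝ) (hE : E = (fun x : EuclideanSpace ℝ (Fin 3) =>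
    deriv (deriv χ) (x 2) * M (x 0 ^ 2 + x 1 ^ 2) * (P x - c) +
      2 * deriv χ (x 2) * N (x 0 ^ 2 + x 1 ^ 2) * ((x 0 * U x 0 + x 1 * U x 1) * U x 2) +
      deriv (deriv χ) (x 2) * M (x 0 ^ 2 + x 1 ^ 2) * U x 2 ^ 2)) :
    Continuous E ∧ Integrable E ∧
    (∀ x : EuclideanSpace ℝ (Fin 3), ¬ (x 0 ^ 2 + x 1 ^ 2 ≤ 4 * T ^ 2 ∧ Z ≤ |x 2| ∧ |x 2| ≤ Z + 1) → E x = 0) ∧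
    (∀ x : EuclideanSpace ℝ (Fin 3), x 0 ^ 2 + x 1 ^ 2 ≤ 4 * T ^ 2 → |E x| ≤ K * (T ^ 2 + T) * (c - P x)) := by
  have hχd_in : ∀ z, |z| < Z → deriv χ z = 0 ∧ deriv (deriv χ) z = 0 := fun z hz =>
    deriv_deriv_eq_zero_of_eventually_const (a := 1) (by
      filter_upwards [(isOpen_lt continuous_abs continuous_const).mem_nhds hz] with w hw
      exact hχ1 w hw.le)
  have hχd_out : ∀ z, Z + 1 < |z| → deriv χ z = 0 ∧ deriv (deriv χ) z = 0 := fun z hz =>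
    deriv_deriv_eq_zero_of_eventually_const (a := 0) (by
      filter_upwards [(isOpen_lt continuous_const continuous_abs).mem_nhds hz] with w hw
      exact hχ0 w hw.le)
  -- smoothness of the derivatives of `χ`
  have hχ'C : ContDiff ℝ (⊤ : ℕ∞) (deriv χ) := (contDiff_infty_iff_deriv.1 hχC).2
  have hχ''C : ContDiff ℝ (⊤ : ℕ∞) (deriv (deriv χ)) := (contDiff_infty_iff_deriv.1 hχ'C).2
  -- coordinates are continuous
  have hco : ∀ i : Fin 3, Continuous fun y : EuclideanSpace ℝ (Fin 3) => y i := fun i =>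
    (EuclideanSpace.proj (𝕜 := ℝ) i).continuous
  have hsC : Continuous fun y : EuclideanSpace ℝ (Fin 3) => y 0 ^ 2 + y 1 ^ 2 := ((hco 0).pow 2).add ((hco 1).pow 2)
  have hUc : ∀ i : Fin 3, Continuous fun y : EuclideanSpace ℝ (Fin 3) => U y i := fun i =>
    (hco i).comp hU.continuous
  have hPc : Continuous P := hP.continuous
  have hKcpt : IsCompact {x : EuclideanSpace ℝ (Fin 3) | x 0 ^ 2 + x 1 ^ 2 ≤ 4 * T ^ 2 ∧ |x 2| ≤ Z + 1} :=
    isCompact_solidCylinder _ _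
  -- the head deficit
  set Qf : EuclideanSpace ℝ (Fin 3) → ℝ := fun x => P x - c + (U x 0 ^ 2 + U x 1 ^ 2 + U x 2 ^ 2) / 2 with hQf
  have hQle : ∀ x, Qf x ≤ 0 := fun x => by
    have h := hQ x
    have hn : ‖U x‖ ^ 2 = U x 0 ^ 2 + U x 1 ^ 2 + U x 2 ^ 2 := by
      rw [EuclideanSpace.norm_sq_eq, Fin.sum_univ_three]; simp [Real.norm_eq_abs, sq_abs]
    rw [hn] at h; simp only [hQf]; linarith
  have hPQ : ∀ x, P x - c ≤ Qf x := fun x => by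
    simp only [hQf]; nlinarith [sq_nonneg (U x 0), sq_nonneg (U x 1), sq_nonneg (U x 2)]
  have hcP : ∀ x, 0 ≤ c - P x := fun x => by linarith [hQle x, hPQ x]
  have hEc : Continuous E := by
    rw [hE]
    have hρ : Continuous fun x : EuclideanSpace ℝ (Fin 3) => x 0 * U x 0 + x 1 * U x 1 :=
      ((hco 0).mul (hUc 0)).add ((hco 1).mul (hUc 1))
    exact ((((hχ''C.continuous.comp (hco 2)).mul (hMC.continuous.comp hsC)).mul (hPc.sub continuous_const)).add
      ((((hχ'C.continuous.comp (hco 2)).const_mul 2).mul (hNC.continuous.comp hsC)).mul (hρ.mul (hUc 2)))).add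
      (((hχ''C.continuous.comp (hco 2)).mul (hMC.continuous.comp hsC)).mul ((hUc 2).pow 2))
  have hE0 : ∀ x : EuclideanSpace ℝ (Fin 3), ¬ (x 0 ^ 2 + x 1 ^ 2 ≤ 4 * T ^ 2 ∧ Z ≤ |x 2| ∧ |x 2| ≤ Z + 1) → E x = 0 := by
    intro x hx
    simp only [not_and_or, not_le] at hx
    rcases hx with hx | hx | hx
    · obtain ⟨h1, -, h3⟩ := hN4T _ hx.le
      simp only [hE, h1, h3]; ring
    · obtain ⟨h1, h2⟩ := hχd_in _ hx
      simp only [hE, h1, h2]; ring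
    · obtain ⟨h1, h2⟩ := hχd_out _ hx
      simp only [hE, h1, h2]; ring
  have hEs : HasCompactSupport E := by
    refine HasCompactSupport.of_support_subset_isCompact hKcpt fun x hx => ?_
    by_contra hxK
    apply hx
    refine hE0 x fun h => hxK ⟨h.1, h.2.2⟩
  have hEi : Integrable E := hEc.integrable_of_hasCompactSupport hEs
  have hEabs : ∀ x : EuclideanSpace ℝ (Fin 3), x 0 ^ 2 + x 1 ^ 2 ≤ 4 * T ^ 2 →
      |E x| ≤ K * (T ^ 2 + T) * (c - P x) := by
    intro x hs4
    have hMb' : |M (x 0 ^ 2 + x 1 ^ 2)| ≤ A * T ^ 2 := hMb _ (by positivity)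
    have hN04' := hN04 (x 0 ^ 2 + x 1 ^ 2) (by positivity)
    have h := density_error_le (Q := Qf x) (U₀ := U x 0) (U₁ := U x 1) (U₂ := U x 2)
      (Nv := N (x 0 ^ 2 + x 1 ^ 2)) (Mv := M (x 0 ^ 2 + x 1 ^ 2)) (χ' := deriv χ (x 2))
      (χ'' := deriv (deriv χ) (x 2)) hT0 hs4 rfl (hχ' (x 2)) (hχ'' (x 2)) hMb'
      hN04'.1 hN04'.2 (hQle x) (hPQ x) (by simp only [hQf])
    refine le_trans (by simpa only [hE] using h) ?_
    exact mul_le_mul_of_nonneg_right hK1 (hcP x)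
  exact ⟨hEc, hEi, hE0, hEabs⟩

/-- **Zone bounds for the swirl-excess density `W`** of the one-stroke test function (density piece 5a
fed with the radial profile of piece 3). -/
theorem core_zone_bounds {U : EuclideanSpace ℝ (Fin 3) → EuclideanSpace ℝ (Fin 3)} {P : EuclideanSpace ℝ (Fin 3) → ℝ}
    {c : ℝ} (hQ : ∀ x, P x + ‖U x‖ ^ 2 / 2 ≤ c) {N : ℝ → ℝ} {t ε T A K : ℝ}
    (hNC : ContDiff ℝ (⊤ : ℕ∞) N) (hcT : (t + ε) ^ 2 ≤ T ^ 2) (htc : t ^ 2 < (t + ε) ^ 2) (hT0 : 0 < T)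
    (hN1 : ∀ s, s ≤ t ^ 2 → N s = 1) (hN'1 : ∀ s, s < t ^ 2 → deriv N s = 0)
    (hNcl : ∀ s, (t + ε) ^ 2 ≤ s → s ≤ T ^ 2 → N s = (t + ε) ^ 2 / s ∧ deriv N s = -((t + ε) ^ 2 / s ^ 2))
    (hN4T : ∀ s, 4 * T ^ 2 ≤ s → N s = 0 ∧ deriv N s = 0 ∧ (0 : ℝ) = 0)
    (hN'np : ∀ s, (t + ε) ^ 2 ≤ s → deriv N s ≤ 0)
    (hNtr : ∀ s, t ^ 2 ≤ s → s ≤ (t + ε) ^ 2 → |s * deriv N s| ≤ A ∧ |N s + s * deriv N s| ≤ A)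
    (hNtp : ∀ s, T ^ 2 ≤ s → s ≤ 4 * T ^ 2 →
      |N s + s * deriv N s| ≤ A * (t + ε) ^ 2 / T ^ 2 ∧ 0 ≤ -(s ^ 2 * deriv N s) ∧ -(s ^ 2 * deriv N s) ≤ A * (t + ε) ^ 2)
    (hK6 : 6 * A ≤ K) (hK4 : 4 * A ≤ K) (hK1 : A ≤ K)
    (W : EuclideanSpace ℝ (Fin 3) → ℝ) (hW : W = (fun x : EuclideanSpace ℝ (Fin 3) =>
    2 * (N (x 0 ^ 2 + x 1 ^ 2) + (x 0 ^ 2 + x 1 ^ 2) * deriv N (x 0 ^ 2 + x 1 ^ 2)) *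
        (P x - c + (U x 0 ^ 2 + U x 1 ^ 2 + U x 2 ^ 2) / 2) +
      deriv N (x 0 ^ 2 + x 1 ^ 2) * ((x 0 * U x 0 + x 1 * U x 1) ^ 2 - (x 0 * U x 1 - x 1 * U x 0) ^ 2) -
      (N (x 0 ^ 2 + x 1 ^ 2) + (x 0 ^ 2 + x 1 ^ 2) * deriv N (x 0 ^ 2 + x 1 ^ 2)) * U x 2 ^ 2)) :
    (∀ x : EuclideanSpace ℝ (Fin 3), x 0 ^ 2 + x 1 ^ 2 ≤ t ^ 2 →
      W x = 2 * (P x - c + (U x 0 ^ 2 + U x 1 ^ 2 + U x 2 ^ 2) / 2) - U x 2 ^ 2) ∧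
    (∀ x : EuclideanSpace ℝ (Fin 3), t ^ 2 < x 0 ^ 2 + x 1 ^ 2 → x 0 ^ 2 + x 1 ^ 2 ≤ (t + ε) ^ 2 →
      W x ≤ K * (c - P x)) ∧
    (∀ x : EuclideanSpace ℝ (Fin 3), (t + ε) ^ 2 < x 0 ^ 2 + x 1 ^ 2 → x 0 ^ 2 + x 1 ^ 2 ≤ T ^ 2 →
      W x ≤ (t + ε) ^ 2 * ((x 0 * U x 1 - x 1 * U x 0) ^ 2 / (x 0 ^ 2 + x 1 ^ 2) ^ 2)) ∧
    (∀ x : EuclideanSpace ℝ (Fin 3), T ^ 2 < x 0 ^ 2 + x 1 ^ 2 → x 0 ^ 2 + x 1 ^ 2 ≤ 4 * T ^ 2 →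
      W x ≤ K * (t + ε) ^ 2 / T ^ 2 * (c - P x) +
        K * (t + ε) ^ 2 * ((x 0 * U x 1 - x 1 * U x 0) ^ 2 / (x 0 ^ 2 + x 1 ^ 2) ^ 2)) ∧
    (∀ x : EuclideanSpace ℝ (Fin 3), 4 * T ^ 2 < x 0 ^ 2 + x 1 ^ 2 → W x = 0) := by
  set c₁ : ℝ := (t + ε) ^ 2 with hc₁
  have hc₁0 : 0 < c₁ := lt_of_le_of_lt (sq_nonneg t) htc
  -- derivative of `N` at `t²`
  have hN'cont : Continuous (deriv N) := (hNC.continuous_deriv (by simp))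
  have hN't2 : deriv N (t ^ 2) = 0 := by
    have hlim : Tendsto (deriv N) (𝓝[<] (t ^ 2)) (𝓝 (deriv N (t ^ 2))) :=
      (hN'cont.tendsto _).mono_left nhdsWithin_le_nhds
    have hev : deriv N =ᶠ[𝓝[<] (t ^ 2)] fun _ => 0 :=
      eventually_nhdsWithin_of_forall fun s hs => hN'1 s hs
    exact tendsto_nhds_unique hlim (tendsto_const_nhds.congr' hev.symm)
  set Qf : EuclideanSpace ℝ (Fin 3) → ℝ := fun x => P x - c + (U x 0 ^ 2 + U x 1 ^ 2 + U x 2 ^ 2) / 2 with hQf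
  have hQle : ∀ x, Qf x ≤ 0 := fun x => by
    have h := hQ x
    have hn : ‖U x‖ ^ 2 = U x 0 ^ 2 + U x 1 ^ 2 + U x 2 ^ 2 := by
      rw [EuclideanSpace.norm_sq_eq, Fin.sum_univ_three]; simp [Real.norm_eq_abs, sq_abs]
    rw [hn] at h; simp only [hQf]; linarith
  have hPQ : ∀ x, P x - c ≤ Qf x := fun x => by
    simp only [hQf]; nlinarith [sq_nonneg (U x 0), sq_nonneg (U x 1), sq_nonneg (U x 2)]
  have hcP : ∀ x, 0 ≤ c - P x := fun x => by linarith [hQle x, hPQ x]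
  have hWcore : ∀ x : EuclideanSpace ℝ (Fin 3), x 0 ^ 2 + x 1 ^ 2 ≤ t ^ 2 → W x = 2 * Qf x - U x 2 ^ 2 := by
    intro x hs
    have h1 : N (x 0 ^ 2 + x 1 ^ 2) = 1 := hN1 _ hs
    have h2 : deriv N (x 0 ^ 2 + x 1 ^ 2) = 0 := by
      rcases lt_or_eq_of_le hs with hs' | hs'
      · exact hN'1 _ hs'
      · rw [hs']; exact hN't2
    simp only [hW, h1, h2]; ring
  -- transition zone
  have hWtrans : ∀ x : EuclideanSpace ℝ (Fin 3), t ^ 2 < x 0 ^ 2 + x 1 ^ 2 → x 0 ^ 2 + x 1 ^ 2 ≤ c₁ →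
      W x ≤ K * (c - P x) := by
    intro x h1 h2
    obtain ⟨b1, b2⟩ := hNtr _ h1.le h2
    have h := density_transition_le (Q := Qf x) (x₀ := x 0) (x₁ := x 1) (U₀ := U x 0) (U₁ := U x 1) (U₂ := U x 2) (by positivity) b1 b2 (hQle x) (hPQ x)
      (by simp only [hQf]) rfl
    rw [hW]
    exact h.trans (mul_le_mul_of_nonneg_right hK6 (hcP x))
  -- clean zone
  have hWclean : ∀ x : EuclideanSpace ℝ (Fin 3), c₁ < x 0 ^ 2 + x 1 ^ 2 → x 0 ^ 2 + x 1 ^ 2 ≤ T ^ 2 →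
      W x ≤ c₁ * ((x 0 * U x 1 - x 1 * U x 0) ^ 2 / (x 0 ^ 2 + x 1 ^ 2) ^ 2) := by
    intro x h1 h2
    obtain ⟨e1, e2⟩ := hNcl _ h1.le h2
    have hs0 : 0 < x 0 ^ 2 + x 1 ^ 2 := hc₁0.trans h1
    simp only [hW, e1, e2]
    exact density_clean_le (Q := Qf x) (ρ := x 0 * U x 0 + x 1 * U x 1) hs0 hc₁0.le
  -- taper zone
  have hWtaper : ∀ x : EuclideanSpace ℝ (Fin 3), T ^ 2 < x 0 ^ 2 + x 1 ^ 2 → x 0 ^ 2 + x 1 ^ 2 ≤ 4 * T ^ 2 →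
      W x ≤ K * c₁ / T ^ 2 * (c - P x) + K * c₁ * ((x 0 * U x 1 - x 1 * U x 0) ^ 2 / (x 0 ^ 2 + x 1 ^ 2) ^ 2) := by
    intro x h1 h2
    obtain ⟨b1, b2, b3⟩ := hNtp _ h1.le h2
    have hs0 : 0 < x 0 ^ 2 + x 1 ^ 2 := (by positivity : (0:ℝ) < T ^ 2).trans h1
    have h := density_taper_le (Q := Qf x) (ρ := x 0 * U x 0 + x 1 * U x 1) (Γ := x 0 * U x 1 - x 1 * U x 0)
      (U₀ := U x 0) (U₁ := U x 1) (U₂ := U x 2) hs0 b1 (hN'np _ (hcT.trans h1.le)) b3 (hQle x) (hPQ x) (by simp only [hQf])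
    rw [hW]
    refine h.trans ?_
    have hA4 : 4 * A ≤ K := hK4
    have hA1 : A ≤ K := hK1
    have hΓ : 0 ≤ (x 0 * U x 1 - x 1 * U x 0) ^ 2 / (x 0 ^ 2 + x 1 ^ 2) ^ 2 := by positivity
    have e1 : 4 * A * c₁ / T ^ 2 * (c - P x) ≤ K * c₁ / T ^ 2 * (c - P x) :=
      mul_le_mul_of_nonneg_right (div_le_div_of_nonneg_right
        (mul_le_mul_of_nonneg_right hA4 hc₁0.le) (by positivity)) (hcP x)
    have e2 : A * c₁ * ((x 0 * U x 1 - x 1 * U x 0) ^ 2 / (x 0 ^ 2 + x 1 ^ 2) ^ 2) ≤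
        K * c₁ * ((x 0 * U x 1 - x 1 * U x 0) ^ 2 / (x 0 ^ 2 + x 1 ^ 2) ^ 2) :=
      mul_le_mul_of_nonneg_right (mul_le_mul_of_nonneg_right hA1 hc₁0.le) hΓ
    linarith
  -- far zone
  have hWfar : ∀ x : EuclideanSpace ℝ (Fin 3), 4 * T ^ 2 < x 0 ^ 2 + x 1 ^ 2 → W x = 0 := by
    intro x h1
    obtain ⟨e1, e2, -⟩ := hN4T _ h1.le
    simp only [hW, e1, e2]; ring
  refine ⟨fun x hx => ?_, hWtrans, hWclean, hWtaper, hWfar⟩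
  rw [hWcore x hx, hQf]


end Summit.NavierStokesRegularity.NavierStokesRegularity.Theorems.GaldiLiouville.AllAxesBudget

end
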